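import Summits.QuantumAdvantage.QuantumAdvantage.Theorems.LinnikCubicClassGroupsDegreeOnePrimesEscapeHeckeWindow
import Summits.QuantumAdvantage.QuantumAdvantage.Theorems.LinnikCubicClassGroupsDegreeOnePrimesEscapeShortIntervalZeroSum
import Summits.QuantumAdvantage.QuantumAdvantage.Theorems.LinnikCubicClassGroupsDegreeOnePrimesEscapePerCharacterDeficitSmoothedBound
import HarnessLib

/-!
# The Deuring-twisted explicit formula of a cyclic `N|E` against a WINDOW weight: the core estimate

Topic `Summits/QuantumAdvantage/QuantumAdvantage/Theorems`, cell B2b-1 (linnik-cubic), PART A (gen 17); helper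
toward the crux `DegreeOnePrimesEscape` (stmt-QuantumAdvantage-11543) of route `LinnikCubicClassGroups` — the
analytic core of the CHEBOTAREV DENSITY THEOREM IN SHORT INTERVALS `(x, x + h]`, `x^{1−δ} ≤ h ≤ x`, in the Linnik
range `x ≥ |d_N|^{L}`, for the conjugacy classes of a Galois extension (Hoheisel's mechanism on the Deuring-twisted
explicit formula).  HONEST FRAMING: the value of this file is a THEOREM (kernel-checked) — NOT summit progress.

`frobWindow_core` is `deuringSum_core_all` (`…DeuringSmoothedCoreAll.lean`, gen 13) with the Thorner–Zaman weight
replaced by the window weight `g = windowTest lo hi ε` (`0 < ε < lo < hi`; `X = e^{hi+ε}`, `ℓ = hi − lo + 2ε`):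
for the Hecke data `(𝔣_j, χ_j, L_j)_{j<m}` of a cyclic `N|E` (`ord_ρ ζ₁_N = ord_ρ ζ₁_E + Σ_{0<j<m} ord_ρ L_j`), a
coefficient `|c| ≤ 1`, finite exceptional sets `Exc j` containing every zero of `ζ₁_N` on the exceptional segment
`excRegion c N`, the log-free density bound for the class-group family of `N`, clause (1) of the Landau–Page
package of `N`, and a height `T₁ ≥ 1` with `e^{b(a log Q + log(T₁+4))} ≤ X^{1/2}`:

  `‖Σ_{j<m} c^j K_j(g) − F(−1) + Σ_j c^j Σ_{ρ ∈ Exc j} m_j(ρ)F(−ρ)‖ ≤ m · (B_N + J)`,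

where `B_N` is the zero sum of `ζ₁_N` off the exceptional segment against the window weight
(`fam_zeroSum_window_le_local` for `N`: flat part `ℓ·2eD·e^{−c L_X/(2(a log Q + log(T₁+4)))}`, the `β < 1/4`
part and the tail `|γ| > T₁`), and `J = 64 Q ℓ + leftLineConst·(A_L(n₀+1))(log|d_N| + log 4 + 1)e^{−(lo−ε)/2}(2M/ε)`
bounds the trivial-zero and left-line terms of each character uniformly (`A_L = max(A_ζ, A_χ)`).
References: [LagariasMontgomeryOdlyzko1979, §§3, 7]; [ThornerZaman2019, §4.3]; G. Hoheisel (1930); A. Balog,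
K. Ono, J. Number Theory 91 (2001); S. Gun, S. L. Naik, arXiv:2405.04698 (2024), Thm. 7.
-/

noncomputable section

open Complex Real MeasureTheory Set Filter Topology NumberField NumberField.InfinitePlace IsDedekindDomain
open scoped NumberField nonZeroDivisors

namespace Summit.QuantumAdvantage.QuantumAdvantage.Theorems.DegreeOnePrimesEscape

open Literature.NumberTheory.LFunctions Literature.NumberTheory.LFunctions.NumberField
  Literature.NumberTheory.LFunctions.EntireEF Literature.NumberTheory.LFunctions.WindowWeight
  Literature.NumberTheory.LFunctions.AbelianDensity

set_option maxHeartbeats 1600000 in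
/-- **The core estimate of the Deuring-twisted window explicit formula** (see the module docstring).
[cite: LagariasMontgomeryOdlyzko1979, §7] [cite: ThornerZaman2019, §4.3] -/
theorem frobWindow_core (n₀ : ℕ) (hn₀ : 1 < n₀) {b D a : ℝ} (hb : 0 < b) (hD : 0 < D) (ha : 1 ≤ a)
    {c : ℝ} (hc : 0 < c)
    {Al Cr M : ℝ} (hAl0 : 0 < Al)
    (hAl : ∀ (K : Type) [Field K] [NumberField K] (χ : ClassGroup (𝓞 K) →* ℂˣ) (t : ℝ),
      ‖logDeriv (classGroupLFunction K χ) (-1 / 2 + t * I)‖ ≤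
        Al * (Module.finrank ℚ K + 1) * (Real.log ((NumberField.discr K).natAbs : ℝ) + Real.log (|t| + 4)))
    (hCr0 : 0 < Cr)
    (hCr : ∀ (K : Type) [Field K] [NumberField K] (𝔪 : Ideal (𝓞 K))
      (ψ : HeightOneSpectrum (𝓞 K) → ℂ) (p : Finset {w : InfinitePlace K // IsReal w}),
      IsRayClassCharacter 𝔪 ψ → IsPrimitive 𝔪 ψ → IsSignType 𝔪 ψ p → 𝔪 ≠ ⊥ →
      ∀ (L L' : ℂ → ℂ), Differentiable ℂ L → (∀ s : ℂ, 1 < s.re → L s = rayClassLSeries 𝔪 ψ s) →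
        Differentiable ℂ L' → (∀ s : ℂ, 1 < s.re → L' s = rayClassLSeries 𝔪 (star ψ) s) →
      ∀ t : ℝ, ‖logDeriv L (-1 / 2 + t * I)‖ ≤
        Cr * (Module.finrank ℚ K + 1) * (Real.log (|(discr K : ℝ)| * (Ideal.absNorm 𝔪 : ℝ)) + Real.log (|t| + 4)))
    (hM : ∀ y : ℝ, |iteratedDeriv 1 Real.smoothTransition y| ≤ M ∧ |iteratedDeriv 2 Real.smoothTransition y| ≤ M)
    (E N : Type) [Field E] [NumberField E] [Field N] [NumberField N] [Algebra E N]
    (hNn : Module.finrank ℚ N = n₀)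
    (hdens : ∀ (T : ℝ), 1 ≤ T → ∀ u : AddChar (Additive (ClassGroup (𝓞 N))) ℂ → Finset ℂ,
        (∀ ψ, ∀ ρ ∈ u ψ, famF N ψ ρ = 0 ∧ 1 / 4 ≤ ρ.re ∧ ρ.re < 1 ∧ |ρ.im| ≤ T) →
        ∀ α : ℝ, α ≤ 1 →
          ∑ ψ, ∑ ρ ∈ u ψ with α ≤ ρ.re, (famMult N ψ ρ : ℝ) ≤
            D * Real.exp (b * (a * Real.log (ThornerZaman.condQn N) + Real.log (T + 4))) ^ (1 - α))
    (hpack : ∀ (χ' : ClassGroup (𝓞 N) →* ℂˣ) (ρ : ℂ),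
      (((χ' = 1 → dedekindZeta₁ N ρ = 0) ∧ (χ' ≠ 1 → classGroupLFunction₀ N χ' ρ = 0)) ∧
        1 - c / (Real.log ((NumberField.discr N).natAbs : ℝ) + Real.log (|ρ.im| + 4)) < ρ.re) →
        ρ.im = 0 ∧ χ' * χ' = 1)
    (m : ℕ) (hm1 : 1 ≤ m)
    (𝔣 : ℕ → Ideal (𝓞 E)) (χ : ℕ → HeightOneSpectrum (𝓞 E) → ℂ)
    (p : ℕ → Finset {w : InfinitePlace E // w.IsReal}) (L L' : ℕ → ℂ → ℂ)
    (hdata : ∀ j, 𝔣 j ≠ ⊥ ∧ IsRayClassCharacter (𝔣 j) (χ j) ∧ IsPrimitive (𝔣 j) (χ j) ∧ IsSignType (𝔣 j) (χ j) (p j))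
    (hnt : ∀ j ∈ Finset.Ico 1 m, ∃ v : HeightOneSpectrum (𝓞 E), ¬ 𝔣 j ≤ v.asIdeal ∧ χ j v ≠ 1)
    (hL : ∀ j ∈ Finset.Ico 1 m, Differentiable ℂ (L j) ∧ ∀ s : ℂ, 1 < s.re → L j s = rayClassLSeries (𝔣 j) (χ j) s)
    (hL' : ∀ j ∈ Finset.Ico 1 m, Differentiable ℂ (L' j) ∧
      ∀ s : ℂ, 1 < s.re → L' j s = rayClassLSeries (𝔣 j) (star (χ j)) s)
    (hord : ∀ ρ : ℂ, analyticOrderNatAt (dedekindZeta₁ N) ρ =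
        analyticOrderNatAt (dedekindZeta₁ E) ρ + ∑ j ∈ Finset.Ico 1 m, analyticOrderNatAt (L j) ρ)
    (h𝔣0 : 𝔣 0 = ⊤) (hχ0 : ∀ v, χ 0 v = 1)
    (hcond : ∀ j ∈ Finset.Ico 1 m, |(NumberField.discr E : ℝ)| * (Ideal.absNorm (𝔣 j) : ℝ) ≤ (NumberField.discr N).natAbs)
    (hdE : ((NumberField.discr E).natAbs : ℝ) ≤ (NumberField.discr N).natAbs)
    (hnEn₀ : (Module.finrank ℚ E : ℝ) ≤ n₀)
    {lo hi ε : ℝ} (hε : 0 < ε) (hεlo : ε < lo) (hlohi : lo < hi) {T₁ : ℝ} (hT₁ : 1 ≤ T₁)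
    (hrange : Real.exp (b * (a * Real.log (ThornerZaman.condQn N) + Real.log (T₁ + 4))) ≤
      Real.exp (hi + ε) ^ ((1 : ℝ) / 2))
    (cc : ℂ) (hcc : ‖cc‖ ≤ 1) (Exc : ℕ → Finset ℂ)
    (hExc0 : ∀ ρ ∈ Exc 0, famF E 0 ρ = 0 ∧ 0 < ρ.re ∧ ρ.re < 1)
    (hExcj : ∀ j ∈ Finset.Ico 1 m, ∀ ρ ∈ Exc j, L j ρ = 0 ∧ 0 < ρ.re ∧ ρ.re < 1)
    (hExc' : ∀ ρ, dedekindZeta₁ N ρ = 0 → 0 < ρ.re → ρ.re < 1 → excRegion c N ρ →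
        (famF E 0 ρ = 0 → ρ ∈ Exc 0) ∧ ∀ j ∈ Finset.Ico 1 m, L j ρ = 0 → ρ ∈ Exc j) :
    ‖∑ j ∈ Finset.range m, cc ^ j * coefFordK (rcCoef (𝔣 j) (χ j)) (windowTest lo hi ε) 0 -
        fordLaplace (windowTest lo hi ε) (-1) +
        (∑ ρ ∈ Exc 0, (famMult E 0 ρ : ℂ) * fordLaplace (windowTest lo hi ε) (-ρ) +
          ∑ j ∈ Finset.Ico 1 m, cc ^ j *
            ∑ ρ ∈ Exc j, (analyticOrderNatAt (L j) ρ : ℂ) * fordLaplace (windowTest lo hi ε) (-ρ))‖ ≤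
      m * (Real.exp (hi + ε) *
        ((hi - lo + 2 * ε) * (2 * Real.exp 1 * D *
            Real.exp (-(c * (hi + ε) / (2 * (a * Real.log (ThornerZaman.condQn N) + Real.log (T₁ + 4)))))) +
          (hi - lo + 2 * ε) * Real.exp (hi + ε) ^ (-(3 : ℝ) / 4) *
            ((NumberField.classNumber N : ℝ) * ((2 * T₁ + 3) *
              ((512 * (Module.finrank ℚ N + 1)) *
                ((Real.log ((NumberField.discr N).natAbs : ℝ) + 3 * Module.finrank ℚ N) + Real.log (T₁ + 5))))) +
          (2 * M / ε) * T₁ ^ (-((1 : ℝ) / 2)) *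
            ((NumberField.classNumber N : ℝ) * ((512 * (Module.finrank ℚ N + 1)) *
              (tailConst₁ * (Real.log ((NumberField.discr N).natAbs : ℝ) + 3 * Module.finrank ℚ N) + tailConst₂)))) +
        (64 * ThornerZaman.condQn N * (hi - lo + 2 * ε) +
          NumberField.leftLineConst * (max Al Cr * ((n₀ : ℝ) + 1)) *
            (Real.log ((NumberField.discr N).natAbs : ℝ) + Real.log 4 + 1) *
            (Real.exp (-((lo - ε) / 2)) * (2 * M / ε)))) := by
  classical
  have hlC := leftLineConst_nonneg
  have hM0 : 0 ≤ M := le_trans (abs_nonneg _) (hM 0).1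
  have hN : 1 < Module.finrank ℚ N := by rw [hNn]; exact hn₀
  have hn2 : (2 : ℝ) ≤ n₀ := by exact_mod_cast hn₀
  set Q : ℝ := ThornerZaman.condQn N with hQ
  have hQ12 : (12 : ℝ) ≤ Q := ThornerZaman.twelve_le_condQn (K := N) hN
  have hQ1 : (1 : ℝ) < Q := by linarith
  have hQ0 : (0 : ℝ) < Q := by linarith
  have hn₀Q : (n₀ : ℝ) ≤ Q := by rw [← hNn]; exact ThornerZaman.finrank_le_condQn (K := N)
  have hnEQ : (Module.finrank ℚ E : ℝ) ≤ Q := hnEn₀.trans hn₀Q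
  have hnE0 : (0 : ℝ) ≤ Module.finrank ℚ E := Nat.cast_nonneg _
  have hm0 : (0 : ℝ) < m := by exact_mod_cast hm1
  have hAC0 : 0 < max Al Cr := lt_max_of_lt_left hAl0
  set g := windowTest lo hi ε with hg
  set ℓ : ℝ := hi - lo + 2 * ε with hℓ
  have hℓ0 : 0 < ℓ := by rw [hℓ]; linarith
  set Rexp : ℝ := Real.exp (-((lo - ε) / 2)) * (2 * M / ε) with hRexp
  have hRexp0 : 0 ≤ Rexp := by positivity
  -- domination of multiplicities and transfer of zeros
  have hdomE : ∀ ρ, analyticOrderNatAt (dedekindZeta₁ E) ρ ≤ analyticOrderNatAt (dedekindZeta₁ N) ρ :=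
    fun ρ ↦ by rw [hord ρ]; exact Nat.le_add_right _ _
  have hdomj : ∀ j ∈ Finset.Ico 1 m, ∀ ρ, analyticOrderNatAt (L j) ρ ≤ analyticOrderNatAt (dedekindZeta₁ N) ρ := by
    intro j hj ρ
    rw [hord ρ]
    exact le_trans (Finset.single_le_sum (f := fun i ↦ analyticOrderNatAt (L i) ρ) (fun _ _ ↦ Nat.zero_le _) hj)
      (Nat.le_add_left _ _)
  have hE2 : dedekindZeta₁ E 2 ≠ 0 := by
    rw [dedekindZeta₁_apply_eq_mul (by norm_num : 1 < (2 : ℂ).re)]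
    exact mul_ne_zero (by norm_num) (NumberField.dedekindZeta_ne_zero_of_one_lt_re E (by norm_num))
  have hzeroE : ∀ ρ, famF E 0 ρ = 0 → dedekindZeta₁ N ρ = 0 := fun ρ h0 ↦
    eq_zero_of_analyticOrderNatAt_le (dedekindZeta₁_differentiable E) (dedekindZeta₁_differentiable N) hE2 hdomE
      (by rwa [famF_zero] at h0)
  have hzeroj : ∀ j ∈ Finset.Ico 1 m, ∀ ρ, L j ρ = 0 → dedekindZeta₁ N ρ = 0 := fun j hj ρ h0 ↦
    dedekindZeta₁_eq_zero_of_dominated (hdata j).1 (hdata j).2.1 (hL j hj).1 (hL j hj).2 (hdomj j hj) h0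
  -- sizes: `log|d_N| ≤ Q − 1`, `log A_j ≤ log|d_N|`, `log|d_E| ≤ log|d_N|`
  obtain ⟨hlogdN0, hlogdN⟩ := log_natAbs_discr_mem N
  rw [← hQ] at hlogdN
  have hdN0 : (0 : ℝ) < ((NumberField.discr N).natAbs : ℝ) := by
    exact_mod_cast Nat.pos_of_ne_zero (Int.natAbs_ne_zero.2 (NumberField.discr_ne_zero N))
  have hlA : ∀ j ∈ Finset.Ico 1 m, 0 ≤ Real.log (|(discr E : ℝ)| * (Ideal.absNorm (𝔣 j) : ℝ)) ∧
      Real.log (|(discr E : ℝ)| * (Ideal.absNorm (𝔣 j) : ℝ)) ≤ Real.log ((NumberField.discr N).natAbs : ℝ) := by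
    intro j hj
    have h1 : (1 : ℝ) ≤ |(discr E : ℝ)| := by
      have := Int.one_le_abs (discr_ne_zero E)
      rw [← Int.cast_abs]; exact_mod_cast this
    have h2 : (1 : ℝ) ≤ (Ideal.absNorm (𝔣 j) : ℝ) := by
      exact_mod_cast Nat.one_le_iff_ne_zero.mpr (by rw [ne_eq, Ideal.absNorm_eq_zero_iff]; exact (hdata j).1)
    have hA1 : (1 : ℝ) ≤ |(discr E : ℝ)| * (Ideal.absNorm (𝔣 j) : ℝ) := by nlinarith
    exact ⟨Real.log_nonneg hA1, Real.log_le_log (by linarith) (hcond j hj)⟩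
  have hlogdE0 : 0 ≤ Real.log ((NumberField.discr E).natAbs : ℝ) := Real.log_natCast_nonneg _
  have hlogdE : Real.log ((NumberField.discr E).natAbs : ℝ) ≤ Real.log ((NumberField.discr N).natAbs : ℝ) := by
    have hdE0 : (0 : ℝ) < ((NumberField.discr E).natAbs : ℝ) := by
      exact_mod_cast Nat.pos_of_ne_zero (Int.natAbs_ne_zero.2 (NumberField.discr_ne_zero E))
    exact Real.log_le_log hdE0 hdE
  have hlog4 : 0 ≤ Real.log 4 := Real.log_nonneg (by norm_num)
  -- the zero sum of `ζ₁_N` off the exceptional segment against the window weight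
  set BN : ℝ := Real.exp (hi + ε) *
        ((hi - lo + 2 * ε) * (2 * Real.exp 1 * D *
            Real.exp (-(c * (hi + ε) / (2 * (a * Real.log (ThornerZaman.condQn N) + Real.log (T₁ + 4)))))) +
          (hi - lo + 2 * ε) * Real.exp (hi + ε) ^ (-(3 : ℝ) / 4) *
            ((NumberField.classNumber N : ℝ) * ((2 * T₁ + 3) *
              ((512 * (Module.finrank ℚ N + 1)) *
                ((Real.log ((NumberField.discr N).natAbs : ℝ) + 3 * Module.finrank ℚ N) + Real.log (T₁ + 5))))) +
          (2 * M / ε) * T₁ ^ (-((1 : ℝ) / 2)) *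
            ((NumberField.classNumber N : ℝ) * ((512 * (Module.finrank ℚ N + 1)) *
              (tailConst₁ * (Real.log ((NumberField.discr N).natAbs : ℝ) + 3 * Module.finrank ℚ N) + tailConst₂))))
    with hBN
  have hBζ : ∀ u : Finset ℂ, (∀ ρ ∈ u, dedekindZeta₁ N ρ = 0 ∧ 0 < ρ.re ∧ ρ.re < 1) →
      ∑ ρ ∈ u with ¬ excRegion c N ρ, (analyticOrderNatAt (dedekindZeta₁ N) ρ : ℝ) * ‖fordLaplace g (-ρ)‖ ≤ BN := by
    intro u hu
    have h := fam_zeroSum_window_le_local (K := N) hb hD ha hN hdens hc hpack hM hε hεlo hlohi hT₁ hrange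
      (fun ψ ↦ if ψ = 0 then u else ∅) (fun ψ ρ hρ ↦ by
        by_cases hψ : ψ = 0
        · subst hψ; simp only [if_true] at hρ; rw [famF_zero]; exact hu ρ hρ
        · simp [hψ] at hρ)
    rw [Finset.sum_eq_single (0 : AddChar (Additive (ClassGroup (𝓞 N))) ℂ)] at h
    · simp only [if_true, famMult, famF_zero] at h
      exact h
    · intro ψ _ hψ; rw [if_neg hψ]; simp
    · intro h0; exact absurd (Finset.mem_univ _) h0
  have hBN0 : 0 ≤ BN := le_trans (Finset.sum_nonneg fun ρ _ ↦ mul_nonneg (Nat.cast_nonneg _) (norm_nonneg _))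
    (hBζ ∅ (fun ρ hρ ↦ absurd hρ (Finset.notMem_empty ρ)))
  -- the uniform junk
  set Jk : ℝ := 64 * Q * ℓ + NumberField.leftLineConst * (max Al Cr * ((n₀ : ℝ) + 1)) *
      (Real.log ((NumberField.discr N).natAbs : ℝ) + Real.log 4 + 1) * Rexp with hJk
  have hJk0 : 0 ≤ Jk := by rw [hJk]; positivity
  -- (a) the characters `χ_j`, `0 < j < m`
  have hBj : ∀ j ∈ Finset.Ico 1 m, ∀ u : Finset ℂ, (∀ ρ ∈ u, L j ρ = 0 ∧ 0 < ρ.re ∧ ρ.re < 1) →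
      ∑ ρ ∈ u with ρ ∉ Exc j, (analyticOrderNatAt (dedekindZeta₁ N) ρ : ℝ) * ‖fordLaplace g (-ρ)‖ ≤ BN := by
    intro j hj u hu
    have hu' : ∀ ρ ∈ u, dedekindZeta₁ N ρ = 0 ∧ 0 < ρ.re ∧ ρ.re < 1 :=
      fun ρ hρ ↦ ⟨hzeroj j hj ρ (hu ρ hρ).1, (hu ρ hρ).2⟩
    refine le_trans (Finset.sum_le_sum_of_subset_of_nonneg (fun ρ hρ ↦ ?_)
      (fun ρ _ _ ↦ mul_nonneg (Nat.cast_nonneg _) (norm_nonneg _))) (hBζ u hu')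
    rw [Finset.mem_filter] at hρ ⊢
    refine ⟨hρ.1, fun hexc ↦ hρ.2 ?_⟩
    exact (hExc' ρ (hu' ρ hρ.1).1 (hu ρ hρ.1).2.1 (hu ρ hρ.1).2.2 hexc).2 j hj (hu ρ hρ.1).1
  have hKj : ∀ j ∈ Finset.Ico 1 m,
      ‖coefFordK (rcCoef (𝔣 j) (χ j)) g 0 +
          ∑ ρ ∈ Exc j, (analyticOrderNatAt (L j) ρ : ℂ) * fordLaplace g (-ρ)‖ ≤ BN + Jk := by
    intro j hj
    obtain ⟨h𝔣, hray, hprim, hsig⟩ := hdata j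
    have h := norm_coefFordK_rcCoef_window_add_exc_le_of_zeros hray hprim hsig h𝔣 (hnt j hj) (hL j hj).1 (hL j hj).2
      (hL' j hj).1 (hL' j hj).2 (hdomj j hj) hCr0 hCr hM hε hεlo hlohi (Exc j) (hExcj j hj) (hBj j hj)
    obtain ⟨hlA0, hlAQ⟩ := hlA j hj
    -- trivial-zero term `8(log A + 6 n_E) ℓ ≤ 64 Q ℓ`
    have h1 : 8 * (Real.log (|(discr E : ℝ)| * (Ideal.absNorm (𝔣 j) : ℝ)) + 6 * Module.finrank ℚ E) * ℓ ≤ 64 * Q * ℓ := by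
      refine mul_le_mul_of_nonneg_right ?_ hℓ0.le
      linarith
    -- left-line term
    have h2 : NumberField.leftLineConst * (Cr * (Module.finrank ℚ E + 1)) *
        (Real.log (|(discr E : ℝ)| * (Ideal.absNorm (𝔣 j) : ℝ)) + Real.log 4 + 1) * Rexp ≤
        NumberField.leftLineConst * (max Al Cr * ((n₀ : ℝ) + 1)) *
          (Real.log ((NumberField.discr N).natAbs : ℝ) + Real.log 4 + 1) * Rexp := by
      refine mul_le_mul_of_nonneg_right ?_ hRexp0
      refine mul_le_mul (mul_le_mul_of_nonneg_left (mul_le_mul (le_max_right _ _) (by linarith)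
        (by positivity) hAC0.le) hlC) (by linarith) (by positivity) (by positivity)
    rw [hJk]
    linarith
  -- (b) the trivial character: `ζ₁_E`
  have hB0 : ∀ u : Finset ℂ, (∀ ρ ∈ u, famF E 0 ρ = 0 ∧ 0 < ρ.re ∧ ρ.re < 1) →
      ∑ ρ ∈ u with ρ ∉ Exc 0, (famMult E 0 ρ : ℝ) * ‖fordLaplace g (-ρ)‖ ≤ BN := by
    intro u hu
    have hu' : ∀ ρ ∈ u, dedekindZeta₁ N ρ = 0 ∧ 0 < ρ.re ∧ ρ.re < 1 :=
      fun ρ hρ ↦ ⟨hzeroE ρ (hu ρ hρ).1, (hu ρ hρ).2⟩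
    refine le_trans (Finset.sum_le_sum fun ρ _ ↦ ?_) (le_trans (Finset.sum_le_sum_of_subset_of_nonneg
      (fun ρ hρ ↦ ?_) (fun ρ _ _ ↦ mul_nonneg (Nat.cast_nonneg _) (norm_nonneg _))) (hBζ u hu'))
    · exact mul_le_mul_of_nonneg_right (by rw [famMult, famF_zero]; exact_mod_cast hdomE ρ) (norm_nonneg _)
    · rw [Finset.mem_filter] at hρ ⊢
      refine ⟨hρ.1, fun hexc ↦ hρ.2 ?_⟩
      exact (hExc' ρ (hu' ρ hρ.1).1 (hu ρ hρ.1).2.1 (hu ρ hρ.1).2.2 hexc).1 (hu ρ hρ.1).1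
  have hK0 : ‖coefFordK (rcCoef (𝔣 0) (χ 0)) g 0 - fordLaplace g (-1) +
      ∑ ρ ∈ Exc 0, (famMult E 0 ρ : ℂ) * fordLaplace g (-ρ)‖ ≤ BN + Jk := by
    have hχ0' : χ 0 = fun _ ↦ (1 : ℂ) := funext hχ0
    -- trivial-zero term `m_0(0) ℓ ≤ 8(log|d_E| + 6 n_E + 3) ℓ ≤ 64 Q ℓ`
    have hM₀ : (famMult E 0 0 : ℝ) * (hi - lo + 2 * ε) ≤ 64 * Q * ℓ := by
      rw [famMult, famF_zero, ← hℓ]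
      refine le_trans (mul_le_mul_of_nonneg_right (analyticOrderNatAt_dedekindZeta₁_zero_le (K := E)) hℓ0.le) ?_
      refine mul_le_mul_of_nonneg_right ?_ hℓ0.le
      linarith
    have hJ0 : ‖dzEFRemainder E g 0‖ ≤ NumberField.leftLineConst * (max Al Cr * ((n₀ : ℝ) + 1)) *
        (Real.log ((NumberField.discr N).natAbs : ℝ) + Real.log 4 + 1) * Rexp := by
      refine (norm_dzEFRemainder_windowTest_zero_le (K := E) hAl0 hAl hM hε hεlo hlohi).trans ?_
      rw [← hRexp]
      refine mul_le_mul_of_nonneg_right ?_ hRexp0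
      refine mul_le_mul (mul_le_mul_of_nonneg_left (mul_le_mul (le_max_left _ _) (by linarith)
        (by positivity) hAC0.le) hlC) (by linarith) (by positivity) (by positivity)
    have h := norm_coefFordK_famF_window_sub_le (K := E) 0 hε hεlo hlohi (Exc 0) hExc0 hB0 hM₀
      (fun _ ↦ hJ0) (fun h ↦ absurd rfl h)
    simp only [if_true] at h
    rw [← hg] at h
    rw [h𝔣0, hχ0', rcCoef_top_one_eq, hJk]
    linarith [h]
  -- (c) summing over `j < m` with `|c^j| ≤ 1`
  have hcpow : ∀ j, ‖cc ^ j‖ ≤ 1 := fun j ↦ by rw [norm_pow]; exact pow_le_one₀ (norm_nonneg _) hcc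
  have hsplit : ∑ j ∈ Finset.range m, cc ^ j * coefFordK (rcCoef (𝔣 j) (χ j)) g 0 - fordLaplace g (-1) +
      (∑ ρ ∈ Exc 0, (famMult E 0 ρ : ℂ) * fordLaplace g (-ρ) +
        ∑ j ∈ Finset.Ico 1 m, cc ^ j * ∑ ρ ∈ Exc j, (analyticOrderNatAt (L j) ρ : ℂ) * fordLaplace g (-ρ)) =
      (coefFordK (rcCoef (𝔣 0) (χ 0)) g 0 - fordLaplace g (-1) +
        ∑ ρ ∈ Exc 0, (famMult E 0 ρ : ℂ) * fordLaplace g (-ρ)) +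
      ∑ j ∈ Finset.Ico 1 m, cc ^ j * (coefFordK (rcCoef (𝔣 j) (χ j)) g 0 +
        ∑ ρ ∈ Exc j, (analyticOrderNatAt (L j) ρ : ℂ) * fordLaplace g (-ρ)) := by
    rw [Finset.range_eq_Ico, Finset.sum_eq_sum_Ico_succ_bot hm1, pow_zero, one_mul]
    simp only [mul_add, Finset.sum_add_distrib]
    ring
  rw [hsplit]
  refine (norm_add_le _ _).trans ?_
  have h2 : ‖∑ j ∈ Finset.Ico 1 m, cc ^ j * (coefFordK (rcCoef (𝔣 j) (χ j)) g 0 +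
      ∑ ρ ∈ Exc j, (analyticOrderNatAt (L j) ρ : ℂ) * fordLaplace g (-ρ))‖ ≤
      ∑ j ∈ Finset.Ico 1 m, (BN + Jk) := by
    refine (norm_sum_le _ _).trans (Finset.sum_le_sum fun j hj ↦ ?_)
    rw [norm_mul]
    calc ‖cc ^ j‖ * ‖coefFordK (rcCoef (𝔣 j) (χ j)) g 0 + ∑ ρ ∈ Exc j, (analyticOrderNatAt (L j) ρ : ℂ) * fordLaplace g (-ρ)‖
        ≤ 1 * (BN + Jk) := mul_le_mul (hcpow j) (hKj j hj) (norm_nonneg _) zero_le_one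
      _ = _ := one_mul _
  rw [Finset.sum_const, Nat.card_Ico, nsmul_eq_mul] at h2
  have hm' : ((m - 1 : ℕ) : ℝ) = m - 1 := by rw [Nat.cast_sub hm1, Nat.cast_one]
  rw [hm'] at h2
  have hBJ0 : 0 ≤ BN + Jk := by positivity
  have e : (m : ℝ) * (BN + Jk) = (BN + Jk) + (m - 1) * (BN + Jk) := by ring
  rw [show (m : ℝ) * (Real.exp (hi + ε) *
        ((hi - lo + 2 * ε) * (2 * Real.exp 1 * D *
            Real.exp (-(c * (hi + ε) / (2 * (a * Real.log (ThornerZaman.condQn N) + Real.log (T₁ + 4)))))) +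
          (hi - lo + 2 * ε) * Real.exp (hi + ε) ^ (-(3 : ℝ) / 4) *
            ((NumberField.classNumber N : ℝ) * ((2 * T₁ + 3) *
              ((512 * (Module.finrank ℚ N + 1)) *
                ((Real.log ((NumberField.discr N).natAbs : ℝ) + 3 * Module.finrank ℚ N) + Real.log (T₁ + 5))))) +
          (2 * M / ε) * T₁ ^ (-((1 : ℝ) / 2)) *
            ((NumberField.classNumber N : ℝ) * ((512 * (Module.finrank ℚ N + 1)) *
              (tailConst₁ * (Real.log ((NumberField.discr N).natAbs : ℝ) + 3 * Module.finrank ℚ N) + tailConst₂)))) +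
        (64 * ThornerZaman.condQn N * (hi - lo + 2 * ε) +
          NumberField.leftLineConst * (max Al Cr * ((n₀ : ℝ) + 1)) *
            (Real.log ((NumberField.discr N).natAbs : ℝ) + Real.log 4 + 1) *
            (Real.exp (-((lo - ε) / 2)) * (2 * M / ε)))) = (m : ℝ) * (BN + Jk) by
    rw [hBN, hJk, hRexp, hℓ, hQ]]
  linarith [hK0, h2]

end Summit.QuantumAdvantage.QuantumAdvantage.Theorems.DegreeOnePrimesEscape

end
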